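import Mathlib
import HarnessLib
import Summits.HubbardSuperconductivity.HubbardSuperconductivity.Theorems.KLProgrammeKLRegimeSplitTwoLegReadingSlopes
import Summits.HubbardSuperconductivity.HubbardSuperconductivity.Theorems.KLProgrammeKLRegimeSplitFrameFnLemmas

/-!
# Route `KLProgramme` — K3's ENGINE child (19855 `KLRegimeEngineV12` and its gen-5 twin), two-leg stubs: the READING-LIPSCHITZ layer on the
# DE-INTERPOLATED carrier (Δ23 / (R-I), p2's `…SplitFrameFn`): two function frames, off-curve reading, and the SUPPLIER of (E3d/e-Fn)
# `TwoLegSlopesFn` from the field strength and ONE gradient bound on the two-leg interpolant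

Cell `gate-hubbard-kl`, seat p1b (g6).  `…TwoLegReadingSlopes` (p480798) proved these for `TrigPolyC4v` frames (`klFermiPoint μ K`, `frameDist`,
`TwoLegSlopes`).  Under the Δ23 ruling (plan g11 2026-08-27T00:30Z; (R-I) core p479563) frames are FUNCTIONS `K : FrameFn`, the Fermi point is
`klFermiPointFn μ K θ = u_{−K}(θ)·dir θ`, the distance is `frameDistFn`, the model reads `toTrigPoly L K`, and the slot text is `TwoLegSlopesFn`
(`…SplitFrameFn` §4).  This file is the token port — the analysis is `…PerturbedFermiCurveTwoFrame` (p479621), which is carrier-free: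

* §1 a function frame with a gradient bound `‖D(onM K)‖ ≤ A₁` on `Momentum` is radially `A₁`-Lipschitz on every ray (`radialLipschitz_of_norm_fderiv_onM_le`,
  Euclidean route: the ray velocity `toLp (dir θ)` has norm `1`, so NO factor `2`); `|K| ≤ A₀` from the order-`0` bound; continuity from differentiability;
* §2 two frames: `|u_K(θ) − u_{K′}(θ)| ≤ frameDistFn K K′/(Dt_min − A₁)` (`abs_klFermiRadiusFn_sub_le`), `‖klFermiPointFn μ K θ − klFermiPointFn μ K′ θ‖ ≤ …`,
  and the (E3c-Fn) reading split (`abs_apply_klFermiPointFn_sub_le_of_frames`);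
* §3 off the curve at a torus momentum of the model band `nambuXiCT L μ (toTrigPoly L K)`: `|S(p_k⃗) − S(klFermiPointFn μ K (θ(k⃗)))| ≤ b·|e_K(k⃗)|/(Dt_min − A₁)`
  (`abs_eval_latticeMomentum_sub_eval_klFermiPointFn_le`; level identity through p2's value bridge `nambuXiCT_toTrigPoly`);
* §4 **`twoLegSlopesFn_of_fieldStrength_of_gradient`**: `TwoLegSlopesFn R … K n` ⇐ (E3d) on the shell + `‖D(evalM S_n)‖ ≤ b`, `b ≤ cz|U|(Dt_min − A₁)`,
  `S_n = symInterp L (klLocSelfEnergyRe … (toTrigPoly L K) n)` (node exactness from (E0), `eval_symInterp_klLocSelfEnergyRe_latticeMomentum`).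

Hypotheses on the frame are the primitive ones (`IsSymmetricFrame`, `Differentiable (onM K)`, `|K| ≤ A₀`, `‖D(onM K)‖ ≤ A₁`, `A₁ < Dt_min`, window);
keying them to `FrameOKFn` in the KL regime is one bookkeeping lemma for whoever instantiates (sum of the slot budgets, as `…FermiPointC4Regime` did for
`FrameOK`).  Everything is PROVED; no definitions; nothing about the model is asserted.  References: BGM 2006 §2.4 Lemma 2.1 (2.40)
[cite: BenfattoGiulianiMastropietro2006]; HOME/p2-g6/DELTA-INTERP.md, INVENTORY-p2.md.
-/

noncomputable section

namespace Summit.HubbardSuperconductivity.HubbardSuperconductivity.Theorems.KLRegimeSplit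

set_option linter.dupNamespace false -- summit = problem name (single-conjunct summit), D-0017

open Real Set
open Literature.MathematicalPhysics.QuantumLattice Literature.MathematicalPhysics.QuantumLattice.BandSectorCounting
open Literature.Probability.LatticeModels
open Summit.HubbardSuperconductivity.HubbardSuperconductivity.Theorems.DispersionFlow
open Summit.HubbardSuperconductivity.HubbardSuperconductivity.Theorems.PerturbedFermiCurve
open Summit.HubbardSuperconductivity.HubbardSuperconductivity.Theorems.KLProgrammeLegKernels

/-! ## §1 A function frame with a gradient bound on `Momentum` -/

/-- `K p = onM K (toLp p)` (definitional). -/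
theorem onM_toLp (K : FrameFn) (p : Fin 2 → ℝ) : onM K (WithLp.toLp 2 p) = K p := rfl

/-- A frame differentiable on `Momentum` is continuous on `Fin 2 → ℝ`. -/
theorem continuous_of_differentiable_onM {K : FrameFn} (hd : Differentiable ℝ (onM K)) : Continuous K := by
  have h : K = fun p => onM K (WithLp.toLp 2 p) := rfl
  rw [h]
  exact hd.continuous.comp (PiLp.continuous_toLp 2 _)

/-- The negative of a frame differentiable on `Momentum` is continuous. -/
theorem continuous_neg_of_differentiable_onM {K : FrameFn} (hd : Differentiable ℝ (onM K)) : Continuous fun p => -K p :=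
  (continuous_of_differentiable_onM hd).neg

/-- **A gradient bound on `Momentum` makes a function frame radially Lipschitz on every ray segment** with the SAME constant:
`‖D(onM K)(q)‖ ≤ A₁` for all `q` gives `|K(s·dir θ) − K(t·dir θ)| ≤ A₁·|s − t|` (the ray velocity `toLp (dir θ)` has Euclidean norm `1`). -/
theorem radialLipschitz_of_norm_fderiv_onM_le {K : FrameFn} (hd : Differentiable ℝ (onM K)) {A₁ : ℝ}
    (hb : ∀ q : Momentum, ‖fderiv ℝ (onM K) q‖ ≤ A₁) (θ : ℝ) :
    ∀ s t : ℝ, s ∈ Icc 0 (π / ‖dir θ‖) → t ∈ Icc 0 (π / ‖dir θ‖) →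
      |K (s • dir θ) - K (t • dir θ)| ≤ A₁ * |s - t| := by
  intro s t hs ht
  set v : Momentum := WithLp.toLp 2 (dir θ) with hv
  set g : ℝ → ℝ := fun r => onM K (r • v) with hg
  have hgr : ∀ r, g r = K (r • dir θ) := fun r => by
    simp only [hg, hv, ← WithLp.toLp_smul]
    rfl
  have hinner : ∀ r : ℝ, HasDerivAt (fun r : ℝ => r • v) v r := fun r => by
    simpa using (hasDerivAt_id r).smul_const v
  have hderiv : ∀ r ∈ Icc 0 (π / ‖dir θ‖),
      HasDerivWithinAt g (fderiv ℝ (onM K) (r • v) v) (Icc 0 (π / ‖dir θ‖)) r := fun r _ => by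
    have h := ((hd (r • v)).hasFDerivAt.comp_hasDerivAt r (hinner r))
    exact h.hasDerivWithinAt
  have hbound : ∀ r ∈ Icc 0 (π / ‖dir θ‖), ‖fderiv ℝ (onM K) (r • v) v‖ ≤ A₁ := fun r _ => by
    refine ((fderiv ℝ (onM K) (r • v)).le_opNorm v).trans ?_
    rw [hv, norm_toLp_dir, mul_one]
    exact hb _
  have h := (convex_Icc (0 : ℝ) (π / ‖dir θ‖)).norm_image_sub_le_of_norm_hasDerivWithin_le hderiv hbound ht hs
  rw [hgr, hgr, Real.norm_eq_abs, Real.norm_eq_abs] at h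
  exact h

/-- The radial Lipschitz bound transported to the perturbation `δ_K = −K` (the shape `…PerturbedFermiCurveTwoFrame` consumes). -/
theorem radialLipschitz_neg_of_norm_fderiv_onM_le {K : FrameFn} (hd : Differentiable ℝ (onM K)) {A₁ : ℝ}
    (hb : ∀ q : Momentum, ‖fderiv ℝ (onM K) q‖ ≤ A₁) (θ : ℝ) :
    ∀ s t : ℝ, s ∈ Icc 0 (π / ‖dir θ‖) → t ∈ Icc 0 (π / ‖dir θ‖) →
      |(fun p => -K p) (s • dir θ) - (fun p => -K p) (t • dir θ)| ≤ A₁ * |s - t| := by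
  intro s t hs ht
  have h := radialLipschitz_of_norm_fderiv_onM_le hd hb θ s t hs ht
  rwa [show (fun p => -K p) (s • dir θ) - (fun p => -K p) (t • dir θ) = -(K (s • dir θ) - K (t • dir θ)) by ring, abs_neg]

/-! ## §2 Two function frames: the Fermi point moves by at most `frameDistFn K K′/(Dt_min − A₁)` -/

section TwoFrames

variable {a b : ℝ} (B : BandBounds a b) {K K' : FrameFn} {A₀ A₁ : ℝ}
  (hKs : IsSymmetricFrame K) (hKs' : IsSymmetricFrame K')
  (hKd : Differentiable ℝ (onM K)) (hKd' : Differentiable ℝ (onM K'))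
  (hK0 : ∀ p : Fin 2 → ℝ, |K p| ≤ A₀) (hK0' : ∀ p : Fin 2 → ℝ, |K' p| ≤ A₀)
  (hK1 : ∀ q : Momentum, ‖fderiv ℝ (onM K) q‖ ≤ A₁) (hA₁ : A₁ < B.Dtmin)
  {μ : ℝ} (hlo : a ≤ μ - A₀) (hhi : μ + A₀ ≤ b)
include B hKs hKs' hKd hKd' hK0 hK0' hK1 hA₁ hlo hhi

/-- **The Fermi radius of a function frame is `1/(Dt_min − A₁)`-Lipschitz in the frame** (sup distance `frameDistFn`): for symmetric frames
`K, K′`, differentiable on `Momentum`, with `|K|, |K′| ≤ A₀`, `‖D(onM K)‖ ≤ A₁ < Dt_min` and `[μ − A₀, μ + A₀] ⊂ [a, b]`: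
`|u_K(θ) − u_{K′}(θ)| ≤ frameDistFn K K′/(Dt_min − A₁)`. [cite: BenfattoGiulianiMastropietro2006, §2.4 Lemma 2.1 (2.40)] -/
theorem abs_klFermiRadiusFn_sub_le (θ : ℝ) :
    |perturbedFermiRadius (fun p => -K p) μ θ - perturbedFermiRadius (fun p => -K' p) μ θ| ≤ frameDistFn K K' / (B.Dtmin - A₁) :=
  abs_perturbedFermiRadius_sub_le B (continuous_neg_of_differentiable_onM hKd) (continuous_neg_of_differentiable_onM hKd')
    (fun p _ => by rw [abs_neg]; exact hK0 p) (fun p _ => by rw [abs_neg]; exact hK0' p) hlo hhi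
    (radialLipschitz_neg_of_norm_fderiv_onM_le hKd hK1 θ) hA₁
    (fun p _ => by
      rw [show -K p - -K' p = -(K p - K' p) by ring, abs_neg]
      exact abs_sub_le_frameDistFn (bddAbove_range_abs_sub hKs (continuous_of_differentiable_onM hKd) hKs'
        (continuous_of_differentiable_onM hKd')) p)

/-- **The Fermi point of a function frame moves by at most `frameDistFn K K′/(Dt_min − A₁)`** (sup norm on `ℝ²`). -/
theorem norm_klFermiPointFn_sub_le (θ : ℝ) :
    ‖klFermiPointFn μ K θ - klFermiPointFn μ K' θ‖ ≤ frameDistFn K K' / (B.Dtmin - A₁) := by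
  unfold klFermiPointFn
  rw [← sub_smul, norm_smul, Real.norm_eq_abs]
  have h := abs_klFermiRadiusFn_sub_le B hKs hKs' hKd hKd' hK0 hK0' hK1 hA₁ hlo hhi θ
  have h0 : 0 ≤ |perturbedFermiRadius (fun p => -K p) μ θ - perturbedFermiRadius (fun p => -K' p) μ θ| := abs_nonneg _
  calc _ ≤ |perturbedFermiRadius (fun p => -K p) μ θ - perturbedFermiRadius (fun p => -K' p) μ θ| * 1 :=
        mul_le_mul_of_nonneg_left (norm_dir_le_one θ) h0
    _ ≤ _ := by rw [mul_one]; exact h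

/-- **(E3c-Fn)'s reading split for two function frames**: for reading functions `F, F′ : FrameFn` with `F` radially `b`-Lipschitz on the ray
`θ` (`b ≥ 0`), `|F(k_F^K(θ)) − F′(k_F^{K′}(θ))| ≤ |F(k_F^{K′}(θ)) − F′(k_F^{K′}(θ))| + b·frameDistFn K K′/(Dt_min − A₁)`. -/
theorem abs_apply_klFermiPointFn_sub_le_of_frames (F F' : FrameFn) {bF : ℝ} (hbF : 0 ≤ bF) {θ : ℝ}
    (hF : ∀ s t : ℝ, s ∈ Icc 0 (π / ‖dir θ‖) → t ∈ Icc 0 (π / ‖dir θ‖) →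
      |F (s • dir θ) - F (t • dir θ)| ≤ bF * |s - t|) :
    |F (klFermiPointFn μ K θ) - F' (klFermiPointFn μ K' θ)| ≤
      |F (klFermiPointFn μ K' θ) - F' (klFermiPointFn μ K' θ)| + bF * (frameDistFn K K' / (B.Dtmin - A₁)) :=
  abs_apply_sub_apply_le_of_two_perturbations B (continuous_neg_of_differentiable_onM hKd)
    (continuous_neg_of_differentiable_onM hKd')
    (fun p _ => by rw [abs_neg]; exact hK0 p) (fun p _ => by rw [abs_neg]; exact hK0' p) hlo hhi
    (radialLipschitz_neg_of_norm_fderiv_onM_le hKd hK1 θ) hA₁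
    (fun p _ => by
      rw [show -K p - -K' p = -(K p - K' p) by ring, abs_neg]
      exact abs_sub_le_frameDistFn (bddAbove_range_abs_sub hKs (continuous_of_differentiable_onM hKd) hKs'
        (continuous_of_differentiable_onM hKd')) p) hbF hF

end TwoFrames

/-! ## §3 Off the curve at a torus momentum of the model band `nambuXiCT L μ (toTrigPoly L K)` -/

section OffCurve

variable {a b : ℝ} (B : BandBounds a b) {K : FrameFn} {A₀ A₁ : ℝ}
  (hKs : IsSymmetricFrame K) (hKd : Differentiable ℝ (onM K))
  (hK0 : ∀ p : Fin 2 → ℝ, |K p| ≤ A₀) (hK1 : ∀ q : Momentum, ‖fderiv ℝ (onM K) q‖ ≤ A₁) (hA₁ : A₁ < B.Dtmin)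
  {μ Λ : ℝ} (hloΛ : a ≤ μ - A₀ - Λ) (hhiΛ : μ + A₀ + Λ ≤ b) (hΛ : 0 ≤ Λ)
include B hKs hKd hK0 hK1 hA₁ hloΛ hhiΛ hΛ

/-- **Reading `S` at a torus momentum of the tube vs. at the curve point of its ray, function frame**: for a symmetric frame `K`,
differentiable on `Momentum`, with `|K| ≤ A₀`, `‖D(onM K)‖ ≤ A₁ < Dt_min`, `[μ − A₀ − Λ, μ + A₀ + Λ] ⊂ [a, b]`, a reading function `S : TrigPolyC4v`
radially `b`-Lipschitz on every ray (`b ≥ 0`) and a torus momentum `k⃗` with `|e_K(k⃗)| ≤ Λ` (band of the model at `toTrigPoly L K`):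
`|S(p_k⃗) − S(klFermiPointFn μ K (θ(k⃗)))| ≤ b·|e_K(k⃗)|/(Dt_min − A₁)`. -/
theorem abs_eval_latticeMomentum_sub_eval_klFermiPointFn_le {L : ℕ} [NeZero L] (S : TrigPolyC4v) {bS : ℝ} (hbS : 0 ≤ bS)
    (hS : ∀ θ s t : ℝ, s ∈ Icc 0 (π / ‖dir θ‖) → t ∈ Icc 0 (π / ‖dir θ‖) →
      |S.eval (s • dir θ) - S.eval (t • dir θ)| ≤ bS * |s - t|)
    {k : TorusSite 2 L} (hk : |nambuXiCT L μ (toTrigPoly L K) k| ≤ Λ) :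
    |S.eval (latticeMomentum L k) - S.eval (klFermiPointFn μ K (momentumAngle L k))| ≤
      bS * (|nambuXiCT L μ (toTrigPoly L K) k| / (B.Dtmin - A₁)) := by
  -- the centred representative in polar form
  set c : Fin 2 → ℝ := torusCentredMomentum L k with hc
  set θ : ℝ := polarAngle c with hθc
  set s : ℝ := ‖momToComplex c‖ with hs
  have hθ : momentumAngle L k = θ := rfl
  have hpol : s • dir θ = c := (polar_repr c).symm
  have hs0 : 0 ≤ s := norm_nonneg _
  have hcn : ‖c‖ ≤ π := (pi_norm_le_iff_of_nonneg Real.pi_pos.le).2 fun i => by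
    rw [Real.norm_eq_abs]; exact abs_torusCentredMomentum_le_pi L k i
  have hs1 : s * ‖dir θ‖ ≤ π := by rw [← norm_smul_dir hs0, hpol]; exact hcn
  -- `S` at the lattice momentum is `S` at the centred representative
  have hSc : S.eval (latticeMomentum L k) = S.eval c := by
    have h := frameShift_toLp_torusCentredMomentum L S k
    rw [frameShift_toLp] at h
    linarith
  -- the frame at the lattice momentum is the frame at the centred representative (periodicity)
  have hKc : K (latticeMomentum L k) = K c := by
    rw [hc, ← centredRep_latticeMomentum, hKs.apply_centredRep]
  -- the perturbed level at `c` is `e_K(k)`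
  have hlev : rayDispersion (θ, s) + (fun p => -K p) (s • dir θ) - μ = nambuXiCT L μ (toTrigPoly L K) k := by
    have h1 : rayDispersion (θ, s) = sqDispersion (s • dir θ) := rfl
    rw [h1, hpol, nambuXiCT_toTrigPoly L hKs, hKc, sqDispersion_eq_eps2, ← torusBand_eq_eps2_torusCentredMomentum]
    ring
  have hAk := abs_le.1 (hK0 (s • dir θ))
  have hek := abs_le.1 hk
  have hwin : rayDispersion (θ, s) ∈ Icc a b := by
    have h2 : rayDispersion (θ, s) = nambuXiCT L μ (toTrigPoly L K) k + K (s • dir θ) + μ := by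
      rw [← hlev]; ring
    rw [h2]
    constructor <;> linarith
  have hlo : a ≤ μ - A₀ := by linarith
  have hhi : μ + A₀ ≤ b := by linarith
  have h := abs_apply_sub_apply_perturbedFermiRadius_le B (continuous_neg_of_differentiable_onM hKd)
    (fun p _ => by rw [abs_neg]; exact hK0 p) hlo hhi (radialLipschitz_neg_of_norm_fderiv_onM_le hKd hK1 θ) hA₁ hs0 hs1 hwin
    (F := fun p => S.eval p) hbS (hS θ)
  beta_reduce at h
  beta_reduce at hlev
  rw [hlev, hpol] at h
  rw [hSc, hθ]
  unfold klFermiPointFn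
  exact h

end OffCurve

/-! ## §4 The (E3d/e-Fn) supplier -/

section Model

variable {L M : ℕ} [NeZero L] [NeZero M]

/-- **SUPPLIER of (E3d/e-Fn) `TwoLegSlopesFn` from the field-strength bound and ONE gradient bound on the two-leg interpolant** (function
frame).  For a symmetric frame `K`, differentiable on `Momentum`, with `|K| ≤ A₀`, `‖D(onM K)‖ ≤ A₁ < Dt_min` and the scale-`n` shell inside the
level window (`[μ − A₀ − Λ_n, μ + A₀ + Λ_n] ⊂ [a, b]`): if (E0) holds for the model at `toTrigPoly L K` (p3's `selfEnergySymmetric_all`), the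
field strength satisfies `|z_n − 1| ≤ cz|U|` on the shell ((E3d), engine), and `S_n = symInterp L (klLocSelfEnergyRe … (toTrigPoly L K) n)` has
`‖D(evalM S_n)‖ ≤ b` with `0 ≤ b ≤ cz·|U|·(Dt_min − A₁)` (engine: `b = coeffNorm 1 S_n`, the first moment of the scale-`n` two-leg kernel), then
`TwoLegSlopesFn R … K n`. -/
theorem twoLegSlopesFn_of_fieldStrength_of_gradient {a b : ℝ} (B : BandBounds a b) {K : FrameFn} {A₀ A₁ : ℝ}
    (hKs : IsSymmetricFrame K) (hKd : Differentiable ℝ (onM K))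
    (hK0 : ∀ p : Fin 2 → ℝ, |K p| ≤ A₀) (hK1 : ∀ q : Momentum, ‖fderiv ℝ (onM K) q‖ ≤ A₁) (hA₁ : A₁ < B.Dtmin)
    {R : RenConsts} {β U μ : ℝ} {n : ℕ}
    (hloΛ : a ≤ μ - A₀ - klScale klE0 n) (hhiΛ : μ + A₀ + klScale klE0 n ≤ b)
    (hE0 : SelfEnergySymmetric L M β U μ (toTrigPoly L K) n)
    (hz : ∀ k ∈ klShell L μ (toTrigPoly L K) n, |klFieldStrength L M β U μ (toTrigPoly L K) n k - 1| ≤ R.cz * |U|)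
    {bS : ℝ} (hbS : 0 ≤ bS)
    (hgrad : ∀ q : Momentum, ‖fderiv ℝ (evalM (symInterp L (klLocSelfEnergyRe L M β U μ (toTrigPoly L K) n))) q‖ ≤ bS)
    (hb : bS ≤ R.cz * |U| * (B.Dtmin - A₁)) :
    TwoLegSlopesFn L M R β U μ K n := by
  intro k hk
  refine ⟨hz k hk, ?_⟩
  have hkΛ : |nambuXiCT L μ (toTrigPoly L K) k| ≤ klScale klE0 n := by
    rw [klShell, mem_momentumShell] at hk; exact hk
  have hpos : 0 < B.Dtmin - A₁ := sub_pos.2 hA₁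
  set S := symInterp L (klLocSelfEnergyRe L M β U μ (toTrigPoly L K) n) with hSdef
  have hread := abs_eval_latticeMomentum_sub_eval_klFermiPointFn_le B hKs hKd hK0 hK1 hA₁ hloΛ hhiΛ
    (by unfold klScale klE0; positivity) S hbS (fun θ => radialLipschitz_eval_of_norm_fderiv_evalM_le S hgrad θ) hkΛ
  rw [eval_symInterp_klLocSelfEnergyRe_latticeMomentum hE0] at hread
  have hloc : klLocalPartFn L M β U μ K n (momentumAngle L k) = S.eval (klFermiPointFn μ K (momentumAngle L k)) := rfl
  rw [hloc]
  refine hread.trans ?_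
  rw [mul_div_assoc', div_le_iff₀ hpos]
  have he : 0 ≤ |nambuXiCT L μ (toTrigPoly L K) k| := abs_nonneg _
  calc bS * |nambuXiCT L μ (toTrigPoly L K) k| ≤ R.cz * |U| * (B.Dtmin - A₁) * |nambuXiCT L μ (toTrigPoly L K) k| :=
        mul_le_mul_of_nonneg_right hb he
    _ = R.cz * |U| * |nambuXiCT L μ (toTrigPoly L K) k| * (B.Dtmin - A₁) := by ring

end Model

end Summit.HubbardSuperconductivity.HubbardSuperconductivity.Theorems.KLRegimeSplit

end
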